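import Summits.CriticalPhenomena.SAWScalingLimit.Theorems.SAWDefectDecoherenceBoundaryClosureRPolygonLocalDarts
import Summits.CriticalPhenomena.SAWScalingLimit.Theorems.SAWDefectDecoherenceBoundaryClosureRSidePhase
import Summits.CriticalPhenomena.SAWScalingLimit.Theorems.SAWDefectDecoherenceBoundaryClosureRInnerPolygonsWalks
import Summits.CriticalPhenomena.SAWScalingLimit.Theorems.SAWDefectDecoherenceBoundaryClosureRLocalL1Normaliser
import HarnessLib

/-!
# Flat boundary balls of an admissible pinned family: phases, darts and masses along the mesh
(crux `BoundaryClosureR`, stmt-CriticalPhenomena-14004, line `polygon-parity-squeeze`, sub-goal of the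
registered stub `polygonLocalIdentity`, step (a); registered helper `flat_phase_eq`)

For an admissible pinned family `(Λ, a, b)` of the datum `D` and a FLAT BOUNDARY BALL `B(z, s)` of form
`k` off the root (`D ∩ B(z,s) = halfPlane k z ∩ B(z,s)`, eventually `Λ_δ` is the exact half-lattice
`{nthr ≤ zigzagForm k}` on the ball, `pt 0 ∉ B̄(z, s)`), eventually along `δ → 0⁺`:

* `flat_phase_eq`: any two boundary mid-edges with scaled midpoints in `B(z, s')`, `s' < s`, satisfy
  `F(e)·|F₀(e')| = F(e')·|F₀(e)|` (`sidePhase_flat`, rescaled by `δ`);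
* `flat_dart_direction`: every boundary dart `v ∼ t` (`v ∈ Λ_δ ∌ t`) with `δ c_v ∈ B(z, s')` heads in the
  direction `c_t - c_v = -n_k/√3` (`zigzag_dangling_direction`);
* `eventually_exists_dart_near`: boundary darts with `δ c_v ∈ B(z, ε)` exist for every `ε > 0`
  (`exists_dart_of_exact_of_notMem` between a face inside `D` — exhaustion — and a face outside — the
  centres of `Λ_δ` lie in `D`);
* `boundary_norms`: `‖F(e)‖ = |F₀(e)| > 0` at every boundary mid-edge (winding rigidity; walks exist in
  the preconnected `Λ_δ`).

References: Duminil-Copin–Smirnov 2012 §2–§3.  No definition is introduced.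
-/

noncomputable section

open scoped Topology ComplexConjugate
open Filter Set Metric
open Literature.Probability.LatticeModels Literature.Probability.RandomPlanarGeometry
open Literature.Probability.RandomPlanarGeometry.SAW
open Summit.CriticalPhenomena.SAWScalingLimit.Theorems.PickHalfPlane

namespace Summit.CriticalPhenomena.SAWScalingLimit.Theorems.PolygonParitySqueeze.PolygonLocal

/-! ### 1. Scaling and the eventual lattice data on a flat ball -/

/-- Scaling of balls: `δ·c ∈ B(z, s) ↔ c ∈ B(z/δ, s/δ)` (`δ > 0`). [folklore] -/
theorem smul_mem_ball_iff {δ : ℝ} (hδ : 0 < δ) (c z : ℂ) (s : ℝ) :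
    (δ : ℂ) * c ∈ ball z s ↔ c ∈ ball ((δ : ℂ)⁻¹ * z) (s / δ) := by
  have hδ0 : (δ : ℂ) ≠ 0 := Complex.ofReal_ne_zero.2 hδ.ne'
  rw [mem_ball, mem_ball, lt_div_iff₀ hδ, dist_eq_norm, dist_eq_norm]
  have : (δ : ℂ) * c - z = (δ : ℂ) * (c - (δ : ℂ)⁻¹ * z) := by field_simp
  rw [this, norm_mul, Complex.norm_real, Real.norm_of_nonneg hδ.le, mul_comm]

/-- **Eventual lattice data on a flat ball off the root.**  Along `δ → 0⁺`: `Λ_δ` simply connected and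
preconnected, `a_δ, b_δ ∈ ∂Ω`, a walk `a_δ → b_δ`, centres in `D`, the root midpoint outside
`B(z, s)`, the exact half-lattice on `B(z, s)`, and `0 < δ`. [folklore] -/
theorem eventually_flatData {D : DobrushinDomain} {ρ : ℝ} {Λ : ℝ → Finset HexVertex} {m : ℝ → ℤ}
    {b : ℝ → Sym2 HexVertex} (hAF : AdmissibleFamily D ρ Λ m b) {a : ℝ → Sym2 HexVertex} {r₀ : ℝ}
    {m₀ : ℝ → ℤ} (hPR : PinnedFlatRoot D Λ b (D.pt 0) a r₀ m₀) {z : ℂ} {k : Fin 6} {s : ℝ}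
    (hex : ∀ᶠ δ : ℝ in 𝓝[>] 0, ∃ nthr : ℤ, ∀ v : HexVertex, (δ : ℂ) * hexCenter v ∈ ball z s →
      (v ∈ Λ δ ↔ nthr ≤ zigzagForm k v))
    (hroot : D.pt 0 ∉ closedBall z s) :
    ∀ᶠ δ : ℝ in 𝓝[>] 0, hexDomainSimplyConnected (Λ δ) ∧
      (hexGraph.induce ((Λ δ : Finset HexVertex) : Set HexVertex)).Preconnected ∧
      a δ ∈ hexDomainBoundary (Λ δ) ∧ b δ ∈ hexDomainBoundary (Λ δ) ∧
      Nonempty (HexMidEdgeSAW (Λ δ) (a δ) (b δ)) ∧ (∀ v ∈ Λ δ, (δ : ℂ) * hexCenter v ∈ D.carrier) ∧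
      (δ : ℂ) * hexMidpoint (a δ) ∉ ball z s ∧
      (∃ nthr : ℤ, ∀ v : HexVertex, (δ : ℂ) * hexCenter v ∈ ball z s → (v ∈ Λ δ ↔ nthr ≤ zigzagForm k v)) ∧
      0 < δ := by
  obtain ⟨-, -, hadm, -, -⟩ := hAF
  obtain ⟨-, -, hrt, hat⟩ := hPR
  have hfar : ∀ᶠ δ : ℝ in 𝓝[>] 0, (δ : ℂ) * hexMidpoint (a δ) ∉ ball z s := by
    have hopen : IsOpen (closedBall z s)ᶜ := isClosed_closedBall.isOpen_compl
    filter_upwards [hat (hopen.mem_nhds hroot)] with δ hδ h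
    exact hδ (ball_subset_closedBall h)
  filter_upwards [hadm, hrt, hfar, hex, self_mem_nhdsWithin] with δ h1 h2 h3 h4 h5
  exact ⟨h1.1, h1.2.2.1, h2.1, h1.2.1, h2.2.1, h1.2.2.2.1, h3, h4, h5⟩

/-! ### 2. One phase per flat ball, dart directions -/

/-- **One phase per flat ball** (rescaled `sidePhase_flat`): eventually, any two boundary mid-edges
with scaled midpoints in `B(z, s')`, `s' < s`, satisfy `F(e)·|F₀(e')| = F(e')·|F₀(e)|`.
[cite: DuminilCopinSmirnov2012, §3 (winding of walks to the boundary)] -/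
theorem flat_phase_eq : ∀ (D : DobrushinDomain) (ρ : ℝ) (Λ : ℝ → Finset HexVertex) (m : ℝ → ℤ) (b : ℝ → Sym2 HexVertex), AdmissibleFamily D ρ Λ m b → ∀ (a : ℝ → Sym2 HexVertex) (r₀ : ℝ) (m₀ : ℝ → ℤ), PinnedFlatRoot D Λ b (D.pt 0) a r₀ m₀ → ∀ (z : ℂ) (k : Fin 6) (s s' : ℝ), s' < s → (∀ᶠ δ : ℝ in 𝓝[>] 0, ∃ nthr : ℤ, ∀ v : HexVertex, (δ : ℂ) * hexCenter v ∈ Metric.ball z s → (v ∈ Λ δ ↔ nthr ≤ zigzagForm k v)) → D.pt 0 ∉ Metric.closedBall z s → ∀ᶠ δ : ℝ in 𝓝[>] 0, ∀ e ∈ hexDomainBoundary (Λ δ), ∀ e' ∈ hexDomainBoundary (Λ δ), (δ : ℂ) * hexMidpoint e ∈ Metric.ball z s' → (δ : ℂ) * hexMidpoint e' ∈ Metric.ball z s' → hexParafermionicObservable (Λ δ) (a δ) hexCriticalFugacity (5 / 8) e * ((‖hexParafermionicObservable (Λ δ) (a δ) hexCriticalFugacity 0 e'‖ : ℝ) : ℂ)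 = hexParafermionicObservable (Λ δ) (a δ) hexCriticalFugacity (5 / 8) e' * ((‖hexParafermionicObservable (Λ δ) (a δ) hexCriticalFugacity 0 e‖ : ℝ) : ℂ) := by
  intro D ρ Λ m b hAF a r₀ m₀ hPR z k s s' hs' hex hroot
  have hsmall : ∀ᶠ δ : ℝ in 𝓝[>] 0, δ < (s - s') / 4 :=
    nhdsWithin_le_nhds (eventually_lt_nhds (by linarith))
  filter_upwards [eventually_flatData hAF hPR hex hroot, hsmall] with δ hδ hδs e he e' he' heb heb'
  obtain ⟨hsc, -, ha, -, -, -, hfar, ⟨nthr, hpin⟩, hδ0⟩ := hδ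
  obtain ⟨hae, u, w, hauw, hw, hu⟩ := ha
  have huw : hexGraph.Adj u w := by rw [hauw] at hae; exact (SimpleGraph.mem_edgeSet _).1 hae
  rw [hauw]
  -- rescale by `δ`
  set x : ℂ := (δ : ℂ)⁻¹ * z with hx
  have hpin' : ∀ v : HexVertex, hexCenter v ∈ ball x (s / δ) → (v ∈ Λ δ ↔ nthr ≤ zigzagForm k v) :=
    fun v hv => hpin v ((smul_mem_ball_iff hδ0 _ z s).2 hv)
  have hroot' : hexMidpoint s(u, w) ∉ ball x (s / δ) := fun h => by
    rw [hauw] at hfar; exact hfar ((smul_mem_ball_iff hδ0 _ z s).2 h)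
  have hsub : ball x (s' / δ) ⊆ ball x (s / δ - 4) := ball_subset_ball (by
    rw [le_sub_iff_add_le, div_add' _ _ _ hδ0.ne', div_le_div_iff_of_pos_right hδ0]; linarith)
  exact sidePhase_flat (Λ δ) hsc u w huw hu hw k nthr x (s / δ) hpin' hroot' e he e' he'
    (hsub ((smul_mem_ball_iff hδ0 _ z s').1 heb)) (hsub ((smul_mem_ball_iff hδ0 _ z s').1 heb'))

/-- **Dart directions on a flat ball**: eventually every boundary dart `v ∼ t` (`v ∈ Λ_δ ∌ t`) with
`δ c_v ∈ B(z, s')`, `s' < s`, satisfies `c_t - c_v = -n_k/√3` (hence `mid - c_v = -n_k/(2√3)`).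
[folklore] -/
theorem flat_dart_direction {D : DobrushinDomain} {ρ : ℝ} {Λ : ℝ → Finset HexVertex} {m : ℝ → ℤ}
    {b : ℝ → Sym2 HexVertex} (hAF : AdmissibleFamily D ρ Λ m b) {a : ℝ → Sym2 HexVertex} {r₀ : ℝ}
    {m₀ : ℝ → ℤ} (hPR : PinnedFlatRoot D Λ b (D.pt 0) a r₀ m₀) {z : ℂ} {k : Fin 6} {s s' : ℝ} (hs' : s' < s)
    (hex : ∀ᶠ δ : ℝ in 𝓝[>] 0, ∃ nthr : ℤ, ∀ v : HexVertex, (δ : ℂ) * hexCenter v ∈ ball z s →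
      (v ∈ Λ δ ↔ nthr ≤ zigzagForm k v))
    (hroot : D.pt 0 ∉ closedBall z s) :
    ∀ᶠ δ : ℝ in 𝓝[>] 0, ∀ v t : HexVertex, v ∈ Λ δ → t ∉ Λ δ → hexGraph.Adj v t →
      (δ : ℂ) * hexCenter v ∈ ball z s' →
      hexCenter t - hexCenter v = -(((Real.sqrt 3)⁻¹ : ℝ) : ℂ) * innerNormal k := by
  have hsmall : ∀ᶠ δ : ℝ in 𝓝[>] 0, δ < s - s' := nhdsWithin_le_nhds (eventually_lt_nhds (by linarith))
  filter_upwards [eventually_flatData hAF hPR hex hroot, hsmall] with δ hδ hδs v t hv ht hvt hvb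
  obtain ⟨-, -, -, -, -, -, -, ⟨nthr, hpin⟩, hδ0⟩ := hδ
  have hv' : nthr ≤ zigzagForm k v := (hpin v (ball_subset_ball hs'.le hvb)).1 hv
  have htb : (δ : ℂ) * hexCenter t ∈ ball z s := by
    have hd : dist ((δ : ℂ) * hexCenter t) ((δ : ℂ) * hexCenter v) ≤ δ := by
      rw [dist_eq_norm, ← mul_sub, norm_mul, Complex.norm_real, Real.norm_of_nonneg hδ0.le]
      have := SidePhaseCorner.dist_hexCenter_le_of_adj hvt
      rw [dist_comm, dist_eq_norm] at this
      nlinarith [norm_nonneg (hexCenter t - hexCenter v)]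
    have := dist_triangle ((δ : ℂ) * hexCenter t) ((δ : ℂ) * hexCenter v) z
    rw [mem_ball] at hvb ⊢
    linarith
  have ht' : ¬ nthr ≤ zigzagForm k t := fun h => ht ((hpin t htb).2 h)
  exact zigzag_dangling_direction k nthr v t hvt hv' ht'

/-! ### 3. Boundary darts exist near the centre of a flat ball -/

/-- A scaled face centre within `2δ` of any point. [folklore] -/
theorem exists_smul_hexCenter_near {δ : ℝ} (hδ : 0 < δ) (w : ℂ) :
    ∃ v : HexVertex, dist ((δ : ℂ) * hexCenter v) w ≤ 2 * δ := by
  obtain ⟨v, hv⟩ := exists_hexCenter_near ((δ : ℂ)⁻¹ * w)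
  refine ⟨v, ?_⟩
  have hδ0 : (δ : ℂ) ≠ 0 := Complex.ofReal_ne_zero.2 hδ.ne'
  have : (δ : ℂ) * hexCenter v - w = (δ : ℂ) * (hexCenter v - (δ : ℂ)⁻¹ * w) := by field_simp
  rw [dist_eq_norm, this, norm_mul, Complex.norm_real, Real.norm_of_nonneg hδ.le]
  rw [dist_eq_norm] at hv
  nlinarith

/-- **Boundary darts near a flat boundary point.**  On a flat ball `B(z, s)` of form `k` (continuum
half-plane piece, eventually exact half-lattice), for every `ε ∈ (0, s]`, eventually some boundary dart
`p ∼ t` (`p ∈ Λ_δ ∌ t`) has `δ c_p ∈ B(z, ε)`: a face deep inside the half-plane is in `Λ_δ` (exhaustion),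
a face outside is not (centres lie in `D`), and `exists_dart_of_exact_of_notMem` links them.
[folklore] -/
theorem eventually_exists_dart_near {D : DobrushinDomain} {ρ : ℝ} {Λ : ℝ → Finset HexVertex} {m : ℝ → ℤ}
    {b : ℝ → Sym2 HexVertex} (hAF : AdmissibleFamily D ρ Λ m b) {a : ℝ → Sym2 HexVertex} {r₀ : ℝ}
    {m₀ : ℝ → ℤ} (hPR : PinnedFlatRoot D Λ b (D.pt 0) a r₀ m₀) {z : ℂ} {k : Fin 6} {s : ℝ}
    (hset : D.carrier ∩ ball z s = halfPlane k z ∩ ball z s)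
    (hex : ∀ᶠ δ : ℝ in 𝓝[>] 0, ∃ nthr : ℤ, ∀ v : HexVertex, (δ : ℂ) * hexCenter v ∈ ball z s →
      (v ∈ Λ δ ↔ nthr ≤ zigzagForm k v))
    (hroot : D.pt 0 ∉ closedBall z s) {ε : ℝ} (hε : 0 < ε) (hεs : ε ≤ s) :
    ∀ᶠ δ : ℝ in 𝓝[>] 0, ∃ p t : HexVertex, p ∈ Λ δ ∧ t ∉ Λ δ ∧ hexGraph.Adj p t ∧
      (δ : ℂ) * hexCenter p ∈ ball z ε := by
  have hexh := hAF.2.2.2.1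
  -- the inner compact `K₊ = B̄(z + (r/2) n_k, r/4)`, `r = ε/20`
  set r : ℝ := ε / 20 with hr
  have hr0 : 0 < r := by positivity
  set K : Set ℂ := closedBall (z + ((r / 2 : ℝ) : ℂ) * innerNormal k) (r / 4) with hK
  have hn1 : ‖innerNormal k‖ = 1 := norm_innerNormal k
  have hlev : ∀ w ∈ closedBall (z + ((r / 2 : ℝ) : ℂ) * innerNormal k) (r / 4),
      r / 4 ≤ ((w - z) * conj (innerNormal k)).re := by
    intro w hw
    have h1 : (((z + ((r / 2 : ℝ) : ℂ) * innerNormal k) - z) * conj (innerNormal k)).re = r / 2 := by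
      rw [add_sub_cancel_left, mul_assoc, Complex.re_ofReal_mul, re_innerNormal_mul_conj, mul_one]
    have h2 := abs_level_le_dist k (z + ((r / 2 : ℝ) : ℂ) * innerNormal k) w
    have h3 : ((w - z) * conj (innerNormal k)).re =
        ((w - (z + ((r / 2 : ℝ) : ℂ) * innerNormal k)) * conj (innerNormal k)).re + r / 2 := by
      have e : (w - z) * conj (innerNormal k) =
          (w - (z + ((r / 2 : ℝ) : ℂ) * innerNormal k)) * conj (innerNormal k) +
            ((z + ((r / 2 : ℝ) : ℂ) * innerNormal k) - z) * conj (innerNormal k) := by ring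
      rw [e, Complex.add_re, h1]
    rw [mem_closedBall] at hw
    have := (abs_le.1 h2).1
    linarith
  have hKball : closedBall (z + ((r / 2 : ℝ) : ℂ) * innerNormal k) (r / 4) ⊆ ball z s := by
    intro w hw
    rw [mem_closedBall, dist_eq_norm] at hw
    rw [mem_ball, dist_eq_norm]
    have : w - z = (w - (z + ((r / 2 : ℝ) : ℂ) * innerNormal k)) + ((r / 2 : ℝ) : ℂ) * innerNormal k := by ring
    rw [this]
    refine (norm_add_le _ _).trans_lt ?_
    rw [norm_mul, hn1, mul_one, Complex.norm_real, Real.norm_of_nonneg (by positivity)]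
    linarith
  have hKD : K ⊆ D.carrier := by
    intro w hw
    have hw' : w ∈ halfPlane k z ∩ ball z s :=
      ⟨(mem_halfPlane_iff_level k z w).2 (lt_of_lt_of_le (by positivity) (hlev w hw)), hKball hw⟩
    rw [← hset] at hw'
    exact hw'.1
  have hKc : IsCompact K := isCompact_closedBall _ _
  have hsmall : ∀ᶠ δ : ℝ in 𝓝[>] 0, δ < r / 8 := nhdsWithin_le_nhds (eventually_lt_nhds (by positivity))
  filter_upwards [eventually_flatData hAF hPR hex hroot, hexh K hKc hKD, hsmall] with δ hδ hKΛ hδr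
  obtain ⟨-, -, -, -, -, hcen, -, ⟨nthr, hpin⟩, hδ0⟩ := hδ
  -- a face of `Λ_δ` inside `K`, a face off `Λ_δ` on the other side
  obtain ⟨v₂, hv₂⟩ := exists_smul_hexCenter_near hδ0 (z + ((r / 2 : ℝ) : ℂ) * innerNormal k)
  obtain ⟨v₁, hv₁⟩ := exists_smul_hexCenter_near hδ0 (z - ((r / 2 : ℝ) : ℂ) * innerNormal k)
  have hv₂K : (δ : ℂ) * hexCenter v₂ ∈ K := mem_closedBall.2 (by linarith)
  have hv₂Λ : v₂ ∈ Λ δ := hKΛ v₂ hv₂K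
  have hv₁b : (δ : ℂ) * hexCenter v₁ ∈ ball z s := by
    rw [mem_ball, dist_eq_norm]
    rw [dist_eq_norm] at hv₁
    have : (δ : ℂ) * hexCenter v₁ - z = ((δ : ℂ) * hexCenter v₁ - (z - ((r / 2 : ℝ) : ℂ) * innerNormal k)) -
        ((r / 2 : ℝ) : ℂ) * innerNormal k := by ring
    rw [this]
    refine (norm_sub_le _ _).trans_lt ?_
    rw [norm_mul, hn1, mul_one, Complex.norm_real, Real.norm_of_nonneg (by positivity)]
    linarith
  have hv₁Λ : v₁ ∉ Λ δ := by
    intro h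
    have hD : (δ : ℂ) * hexCenter v₁ ∈ D.carrier ∩ ball z s := ⟨hcen v₁ h, hv₁b⟩
    rw [hset] at hD
    have hpos := (mem_halfPlane_iff_level k z _).1 hD.1
    have h1 : (((z - ((r / 2 : ℝ) : ℂ) * innerNormal k) - z) * conj (innerNormal k)).re = -(r / 2) := by
      rw [sub_sub_cancel_left, neg_mul, Complex.neg_re, mul_assoc, Complex.re_ofReal_mul,
        re_innerNormal_mul_conj, mul_one]
    have h2 := abs_level_le_dist k (z - ((r / 2 : ℝ) : ℂ) * innerNormal k) ((δ : ℂ) * hexCenter v₁)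
    have h3 : (((δ : ℂ) * hexCenter v₁ - z) * conj (innerNormal k)).re =
        (((δ : ℂ) * hexCenter v₁ - (z - ((r / 2 : ℝ) : ℂ) * innerNormal k)) * conj (innerNormal k)).re + -(r / 2) := by
      have e : ((δ : ℂ) * hexCenter v₁ - z) * conj (innerNormal k) =
          ((δ : ℂ) * hexCenter v₁ - (z - ((r / 2 : ℝ) : ℂ) * innerNormal k)) * conj (innerNormal k) +
            ((z - ((r / 2 : ℝ) : ℂ) * innerNormal k) - z) * conj (innerNormal k) := by ring
      rw [e, Complex.add_re, h1]
    have := (abs_le.1 h2).2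
    linarith
  -- both centres lie in `B(z, r)`; rescale and link
  have hcv₂ : (δ : ℂ) * hexCenter v₂ ∈ ball z r := by
    rw [mem_ball]
    have := dist_triangle ((δ : ℂ) * hexCenter v₂) (z + ((r / 2 : ℝ) : ℂ) * innerNormal k) z
    have e : dist (z + ((r / 2 : ℝ) : ℂ) * innerNormal k) z = r / 2 := by
      rw [dist_eq_norm, add_sub_cancel_left, norm_mul, hn1, mul_one, Complex.norm_real,
        Real.norm_of_nonneg (by positivity)]
    linarith
  have hcv₁ : (δ : ℂ) * hexCenter v₁ ∈ ball z r := by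
    rw [mem_ball]
    have := dist_triangle ((δ : ℂ) * hexCenter v₁) (z - ((r / 2 : ℝ) : ℂ) * innerNormal k) z
    have e : dist (z - ((r / 2 : ℝ) : ℂ) * innerNormal k) z = r / 2 := by
      rw [dist_eq_norm, sub_sub_cancel_left, norm_neg, norm_mul, hn1, mul_one, Complex.norm_real,
        Real.norm_of_nonneg (by positivity)]
    linarith
  set x : ℂ := (δ : ℂ)⁻¹ * z with hx
  have hpin' : ∀ v : HexVertex, hexCenter v ∈ ball x (s / δ) → (v ∈ Λ δ ↔ nthr ≤ zigzagForm k v) :=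
    fun v hv => hpin v ((smul_mem_ball_iff hδ0 _ z s).2 hv)
  have hR : 9 * (r / δ) + 5 ≤ s / δ := by
    rw [show 9 * (r / δ) + 5 = (9 * r + 5 * δ) / δ by field_simp, div_le_div_iff_of_pos_right hδ0]
    have : 20 * r = ε := by rw [hr]; ring
    nlinarith
  obtain ⟨p, t, hp, ht, hpt, hpb⟩ := exists_dart_of_exact_of_notMem (Λ δ) k nthr x (s / δ) (r / δ) hpin'
    (by positivity) hR v₁ v₂ hv₁Λ hv₂Λ ((smul_mem_ball_iff hδ0 _ z r).1 hcv₁)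
    ((smul_mem_ball_iff hδ0 _ z r).1 hcv₂)
  refine ⟨p, t, hp, ht, hpt, ?_⟩
  have hpb' : (δ : ℂ) * hexCenter p ∈ ball z (δ * (9 * (r / δ) + 5)) := by
    rw [smul_mem_ball_iff hδ0 _ z, mul_div_cancel_left₀ _ hδ0.ne']
    exact hpb
  refine ball_subset_ball ?_ hpb'
  rw [show δ * (9 * (r / δ) + 5) = 9 * r + 5 * δ by field_simp]
  have : 20 * r = ε := by rw [hr]; ring
  nlinarith

/-! ### 4. Boundary norms -/

/-- **Boundary norms**: eventually, at every boundary mid-edge `e` of `Λ_δ`, `‖F_{5/8}(e)‖ = |F₀(e)|`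
(winding rigidity) and `0 < |F₀(e)|` (a walk `a_δ → e` exists in the preconnected `Λ_δ`); the same at
the normaliser `b_δ`. [cite: DuminilCopinSmirnov2012, §3 (winding of walks to the boundary)] -/
theorem boundary_norms {D : DobrushinDomain} {ρ : ℝ} {Λ : ℝ → Finset HexVertex} {m : ℝ → ℤ}
    {b : ℝ → Sym2 HexVertex} (hAF : AdmissibleFamily D ρ Λ m b) {a : ℝ → Sym2 HexVertex} {r₀ : ℝ}
    {m₀ : ℝ → ℤ} (hPR : PinnedFlatRoot D Λ b (D.pt 0) a r₀ m₀) :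
    ∀ᶠ δ : ℝ in 𝓝[>] 0, (∀ e ∈ hexDomainBoundary (Λ δ),
      ‖hexParafermionicObservable (Λ δ) (a δ) hexCriticalFugacity (5 / 8) e‖ =
        ‖hexParafermionicObservable (Λ δ) (a δ) hexCriticalFugacity 0 e‖ ∧
      0 < ‖hexParafermionicObservable (Λ δ) (a δ) hexCriticalFugacity 0 e‖) ∧
      b δ ∈ hexDomainBoundary (Λ δ) := by
  obtain ⟨-, -, hadm, -, -⟩ := hAF
  obtain ⟨-, -, hrt, -⟩ := hPR
  filter_upwards [hadm, hrt] with δ h1 h2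
  refine ⟨fun e he => ⟨LocalL1.norm_observable_eq_norm_zero_spin_of_mem_boundary h1.1 h2.1 he _ _, ?_⟩, h1.2.1⟩
  by_cases hea : a δ = e
  · rw [← hea, GateMass.norm_obs_zero_self h2.1]; exact one_pos
  · exact (GateMass.norm_obs_zero_pos_iff _ _ _).2
      (nonempty_hexMidEdgeSAW_of_preconnected (Λ δ) (a δ) e h1.2.2.1 h2.1 he hea)

end Summit.CriticalPhenomena.SAWScalingLimit.Theorems.PolygonParitySqueeze.PolygonLocal

end
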